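import Summits.BirchSwinnertonDyer.BirchSwinnertonDyer.Theorems.ByReductionTypeAtTwoRankOneSigmaHeightNonvanishing
import Summits.BirchSwinnertonDyer.BirchSwinnertonDyer.Theorems.ByReductionTypeAtTwoRankOneSigmaHeightLevelOne
import Literature.NumberTheory.EllipticCurves.SteinWuthrich2013.SplitLogUniformizationProofs
import HarnessLib

/-!
# Route `ByReductionTypeAtTwo`, crux `RankOneAtTwoBigImageOddLocal` (item stmt-BirchSwinnertonDyer-23715), line AN62, σ₀-LEMMA BLOCK
# (cell `bsd-f1-sign2`, planner seat `-an` g50; `--supports 23715`, helper):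
# **A LOG-FREE NON-VANISHING CERTIFICATE: `num x(Q) ≢ 1 + 8a₄ (mod 32)` ⟹ `⟨Q,Q⟩_D ≠ 0` at level one**

HONEST FRAMING (D-0036/D-0054): THEOREMS ONLY (no definition, no named fact, no `sorry`, no instance).  With the binders of the
unconditional level-one law (`…SigmaHeightLevelOneLawUnconditional`: `V/ℚ` `ℤ`-integral, `a₁ = 0`, `D` a σ-form height datum at `2`) and
`Q = (x, y)` of level one (`‖x‖₂ = 4`) with non-singular reduction everywhere: `a := num x ≡ 1 (mod 4)` (level-one residue law), so
`‖log₂ a − (a − 1)‖₂ ≤ 2‖a − 1‖₂²` (tree `SteinWuthrich2013.norm_padicLog_one_add_sub_le`, valid at `p = 2`); hence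
`‖log₂ a − 8a₄‖₂ > 1/32` as soon as the INTEGER `a − 1 − 8a₄` is not divisible by `32` (`lt_norm_padicLog_num_sub_of_not_dvd`), and then
`⟨Q,Q⟩_D ≠ 0` by `pairing_ne_zero_of_lt_norm_sub` (`pairing_ne_zero_of_not_dvd`; for `P` with `mP = Q`: `pairing_self_ne_zero_of_nsmul_eq_of_not_dvd`,
and `P` has infinite order).  This is the residue form of the «three-bit certificate»: the bits are `a₂ mod 2` (covered: `a₂` odd forces
`a ≡ 5 (mod 8)`, so `32 ∤ a − 1 − 8a₄`) and `(a − 1 − 8a₄)/8 mod 4`.  Nothing here is a statement about `BSDp`; item 23715 stays OPEN; BSD is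
proved for no curve.  References: [cite: Gouvea1993PadicNumbers, §5.7 Prop. 5.7.8] [cite: SilvermanAEC2009, VII.2.2] [cite: MazurSteinTate2006, §1].
-/

set_option autoImplicit false

noncomputable section

open scoped Classical

open WeierstrassCurve PowerSeries Literature Literature.NumberTheory.EllipticCurves

namespace Summit.BirchSwinnertonDyer.BirchSwinnertonDyer.Theorems

namespace NaiveSigmaLogAtTwo

/-- `‖num x − 1‖₂ ≤ ¼` at level one (`a₁ = 0`): `num x ≡ 1 + 4a₂ ≡ 1 (mod 4)`. [cite: SilvermanAEC2009, VII.2.2] -/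
theorem norm_cast_num_sub_one_le_quarter (V : WeierstrassCurve ℚ) [V.IsIntegral ℤ] {x y : ℚ} (h : V.toAffine.Nonsingular x y)
    (ha1 : V.a₁ = 0) (hx : ‖(x : ℚ_[2])‖ = 4) : ‖(x.num : ℚ_[2]) - 1‖ ≤ 4⁻¹ := by
  have h8 := norm_cast_num_sub_le_of_norm_eq_four V h ha1 hx
  have ha2 : ‖(V.a₂ : ℚ_[2])‖ ≤ 1 := (mem_localIntegers_iff 2 _).mp (V.a₂_mem_localIntegers 2)
  have h4 : ‖(4 : ℚ_[2]) * (V.a₂ : ℚ_[2])‖ ≤ 4⁻¹ := by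
    have h2 : ‖(2 : ℚ_[2])‖ = 2⁻¹ := by
      have := Padic.norm_p (p := 2); exact_mod_cast this
    have h4n : ‖(4 : ℚ_[2])‖ = 4⁻¹ := by
      rw [show (4 : ℚ_[2]) = 2 * 2 by norm_num, norm_mul, h2]; norm_num
    rw [norm_mul, h4n]
    calc (4⁻¹ : ℝ) * ‖(V.a₂ : ℚ_[2])‖ ≤ 4⁻¹ * 1 := by gcongr
      _ = 4⁻¹ := by ring
  have e : (x.num : ℚ_[2]) - 1 = ((x.num : ℚ_[2]) - 1 - 4 * (V.a₂ : ℚ_[2])) + 4 * (V.a₂ : ℚ_[2]) := by ring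
  rw [e]
  exact (Padic.nonarchimedean _ _).trans (max_le (h8.trans (by norm_num)) h4)

/-- **`‖log₂ num x − 8a₄‖₂ > 1/32` whenever `32 ∤ num x − 1 − 8a₄`** (level one, `a₁ = 0`): `log₂ a ≡ a − 1` to second order
(`‖log₂(1+t) − t‖ ≤ 2‖t‖²`, `‖t‖ ≤ ¼`). [cite: Gouvea1993PadicNumbers, §5.7 Prop. 5.7.8] -/
theorem lt_norm_padicLog_num_sub_of_not_dvd (V : WeierstrassCurve ℚ) [V.IsIntegral ℤ] {x y : ℚ} (h : V.toAffine.Nonsingular x y)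
    (ha1 : V.a₁ = 0) (hx : ‖(x : ℚ_[2])‖ = 4) {A₄ : ℤ} (hA4 : V.a₄ = A₄) (h32 : ¬ (32 : ℤ) ∣ x.num - 1 - 8 * A₄) :
    32⁻¹ < ‖padicLog 2 (x.num : ℚ_[2]) - 8 * (V.a₄ : ℚ_[2])‖ := by
  set a : ℚ_[2] := (x.num : ℚ_[2]) with hadef
  set t : ℚ_[2] := a - 1 with htdef
  have ht4 : ‖t‖ ≤ 4⁻¹ := norm_cast_num_sub_one_le_quarter V h ha1 hx
  have hA4c : (V.a₄ : ℚ_[2]) = (A₄ : ℚ_[2]) := by rw [hA4]; push_cast; rfl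
  -- the integer `n = a − 1 − 8A₄` has `‖n‖ > 1/32`
  set n : ℚ_[2] := t - 8 * (A₄ : ℚ_[2]) with hndef
  have hn : ((x.num - 1 - 8 * A₄ : ℤ) : ℚ_[2]) = n := by push_cast; rfl
  have hn32 : 32⁻¹ < ‖n‖ := by
    by_contra hle
    push Not at hle
    have : ‖((x.num - 1 - 8 * A₄ : ℤ) : ℚ_[2])‖ ≤ (2 : ℝ) ^ (-(5 : ℕ) : ℤ) := by rw [hn]; norm_num; linarith
    exact h32 (by have := (Padic.norm_int_le_pow_iff_dvd (p := 2) _ 5).mp (by exact_mod_cast this); norm_num at this; exact this)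
  -- second-order logarithm
  have hlog : ‖padicLog 2 a - t‖ ≤ 2 * ‖t‖ ^ 2 := by
    have ht2 : ‖t‖ ≤ ((2 : ℕ) : ℝ)⁻¹ := ht4.trans (by norm_num)
    have := SteinWuthrich2013.norm_padicLog_one_add_sub_le (p := 2) ht2
    rwa [show (1 : ℚ_[2]) + t = a by rw [htdef]; ring] at this
  have e : padicLog 2 a - 8 * (V.a₄ : ℚ_[2]) = (padicLog 2 a - t) + n := by rw [hA4c, hndef]; ring
  rw [e]
  have h8A : ‖(8 : ℚ_[2]) * (A₄ : ℚ_[2])‖ ≤ 8⁻¹ := by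
    have h2 : ‖(2 : ℚ_[2])‖ = 2⁻¹ := by
      have := Padic.norm_p (p := 2); exact_mod_cast this
    have h8n : ‖(8 : ℚ_[2])‖ = 8⁻¹ := by
      rw [show (8 : ℚ_[2]) = 2 * 2 * 2 by norm_num, norm_mul, norm_mul, h2]; norm_num
    rw [norm_mul, h8n]
    calc (8⁻¹ : ℝ) * ‖(A₄ : ℚ_[2])‖ ≤ 8⁻¹ * 1 := by gcongr; exact Padic.norm_int_le_one _
      _ = 8⁻¹ := by ring
  by_cases ht8 : ‖t‖ ≤ 8⁻¹
  · -- `‖log a − t‖ ≤ 2/64 = 1/32 < ‖n‖`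
    have hsmall : ‖padicLog 2 a - t‖ < ‖n‖ := by
      refine lt_of_le_of_lt (hlog.trans ?_) hn32
      nlinarith [norm_nonneg t]
    rw [Padic.add_eq_max_of_ne (ne_of_lt hsmall), max_eq_right hsmall.le]
    exact hn32
  · -- `⅛ < ‖t‖ ≤ ¼`: `‖log a − t‖ ≤ ‖t‖/2 < ‖t‖ = ‖n‖`
    push Not at ht8
    have hnt : ‖n‖ = ‖t‖ := by
      rw [hndef, sub_eq_add_neg, Padic.add_eq_max_of_ne, max_eq_left]
      · rw [norm_neg]; exact h8A.trans ht8.le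
      · rw [norm_neg]; exact (ne_of_lt (lt_of_le_of_lt h8A ht8)).symm
    have hsmall : ‖padicLog 2 a - t‖ < ‖n‖ := by
      rw [hnt]
      refine lt_of_le_of_lt hlog ?_
      nlinarith [norm_nonneg t]
    rw [Padic.add_eq_max_of_ne (ne_of_lt hsmall), max_eq_right hsmall.le, hnt]
    linarith

/-- **LOG-FREE CERTIFICATE (kernel)**: for a level-one point `Q = (x, y)` (`‖x‖₂ = 4`) with non-singular reduction everywhere on a
`ℤ`-integral model with `a₁ = 0`, and ANY σ-form height datum `D` at `2`: **`32 ∤ num x − 1 − 8a₄ ⟹ ⟨Q,Q⟩_D ≠ 0`**.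
[cite: MazurSteinTate2006, §1] [cite: Gouvea1993PadicNumbers, §5.7 Prop. 5.7.8] -/
theorem pairing_ne_zero_of_not_dvd (V : WeierstrassCurve ℚ) [V.IsIntegral ℤ] (ha1 : V.a₁ = 0)
    (Sq : ℚ_[2]⟦X⟧) (h0 : constantCoeff Sq = 0) (h1 : coeff 1 Sq = 0) (h2 : coeff 2 Sq = 1) (h3 : coeff 3 Sq = 0)
    (hODE : (V.baseChange ℚ_[2]).SatisfiesSigmaSqODE Sq 0) (D : PAdicHeightData V 2)
    (hD : ∀ {x y : ℚ} (h : V.toAffine.Nonsingular x y), V.SatisfiesLocalConditions 2 (.some x y h) →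
      D.pairing (.some x y h) (.some x y h) = padicLog 2 ((x.den : ℚ) : ℚ_[2]) - padicLog 2 (padicEval Sq (-(x : ℚ_[2]) / y)))
    {x y : ℚ} (h : V.toAffine.Nonsingular x y) (hx : ‖(x : ℚ_[2])‖ = 4)
    (hns : ∀ ℓ : ℕ, ℓ.Prime → V.HasNonsingularReductionAt ℓ x y) {A₄ : ℤ} (hA4 : V.a₄ = A₄)
    (h32 : ¬ (32 : ℤ) ∣ x.num - 1 - 8 * A₄) :
    D.pairing (.some x y h) (.some x y h) ≠ 0 :=
  pairing_ne_zero_of_lt_norm_sub V ha1 Sq h0 h1 h2 h3 hODE D hD h hx hns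
    (lt_norm_padicLog_num_sub_of_not_dvd V h ha1 hx hA4 h32)

/-- The same certificate for any `P` with a level-one multiple `mP = Q` as above: `⟨P,P⟩_D ≠ 0`, and `P` has infinite order.
[cite: MazurSteinTate2006, §1] -/
theorem pairing_self_ne_zero_of_nsmul_eq_of_not_dvd (V : WeierstrassCurve ℚ) [V.IsIntegral ℤ] (ha1 : V.a₁ = 0)
    (Sq : ℚ_[2]⟦X⟧) (h0 : constantCoeff Sq = 0) (h1 : coeff 1 Sq = 0) (h2 : coeff 2 Sq = 1) (h3 : coeff 3 Sq = 0)
    (hODE : (V.baseChange ℚ_[2]).SatisfiesSigmaSqODE Sq 0) (D : PAdicHeightData V 2)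
    (hD : ∀ {x y : ℚ} (h : V.toAffine.Nonsingular x y), V.SatisfiesLocalConditions 2 (.some x y h) →
      D.pairing (.some x y h) (.some x y h) = padicLog 2 ((x.den : ℚ) : ℚ_[2]) - padicLog 2 (padicEval Sq (-(x : ℚ_[2]) / y)))
    (P : V.toAffine.Point) (m : ℕ) {x y : ℚ} (h : V.toAffine.Nonsingular x y) (hm : m • P = .some x y h)
    (hx : ‖(x : ℚ_[2])‖ = 4) (hns : ∀ ℓ : ℕ, ℓ.Prime → V.HasNonsingularReductionAt ℓ x y) {A₄ : ℤ} (hA4 : V.a₄ = A₄)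
    (h32 : ¬ (32 : ℤ) ∣ x.num - 1 - 8 * A₄) :
    D.pairing P P ≠ 0 ∧ ¬ IsOfFinAddOrder P := by
  have hne := pairing_self_ne_zero_of_nsmul_eq_of_lt_norm_sub V ha1 Sq h0 h1 h2 h3 hODE D hD P m h hm hx hns
    (lt_norm_padicLog_num_sub_of_not_dvd V h ha1 hx hA4 h32)
  exact ⟨hne, not_isOfFinAddOrder_of_pairing_self_ne_zero D P hne⟩

end NaiveSigmaLogAtTwo

end Summit.BirchSwinnertonDyer.BirchSwinnertonDyer.Theorems
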